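import Summits.NavierStokesRegularity.FunctionalMining.NoGo.TopEigSaturatingKill
import Summits.NavierStokesRegularity.FunctionalMining.TopEigDanskinCurve
import HarnessLib

/-!
# FunctionalMining — the transport identity for the `λ₁` weight, part 1: one-sided channels
# along translates (towards LEMMA ADV in selection form)

Search for candidate a priori estimates; no regularity claim. Cell `pub-nsfunc`, prove seat
(gen 24). Item (D1) "kernel WANTED" of the no-go seat's SELKILL-NOTE §2 (QN4-NOTE LEMMA ADV): the
transport part `Σₖ wₖ ∂ₖS` of the Euler strain tendency `E_w` (`TopEig.eulerStrainVec`) produces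
NOTHING through any top selection. This file is the channel-by-channel half; the assembly (LEMMA ADV,
the Danskin ends, and the consequence for the static door `TopEigSelKillAt`) is
`TopEigTransportSelection.lean`.

Setting: `v` smooth on `T^d` (`d` nonempty finite), `div v = 0` (so `λ₁ = λ(S(v)) ≥ 0`), real
`q ≥ 1`, weight `W(x) = q λ₁(x)^{q−1}`, `S = strainFlat v`, `μ(A; M) = dirTopEig A M` (the largest
value of `eᵀMe` over unit top vectors `e` of `A`), `∂ᵤS(x) = Torus.lineDeriv S x u` for a constant
direction `u ∈ ℝ^d` (`∂ₖ = Torus.partialDeriv k` is `u = eₖ`).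

* §1 torus lemmas: `norm_translate_sub_le` (a `C¹` function is Lipschitz along lines, mean value
  inequality), `integral_mul_slope_comm` (the slope moves onto the weight:
  `∫ H (G(· + a) − G)/t = ∫ G (H(· − a) − H)/t`, translation invariance of Haar measure),
  `tendsto_integral_mul_slope` (dominated convergence of weighted slopes along a direction when the
  right derivative exists at EVERY point and the function is Lipschitz along lines).
* §2 `TopEig.hasDerivWithinAt_rpow_topEig_translate` — **Danskin along a translate**: for EVERY `x`,
  `t ↦ λ₁(x + tu)^q` has the right derivative `W(x) μ(S(x); ∂ᵤS(x))` at `t = 0⁺` (the strain of the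
  translate is the curve `t ↦ S(x + tu)` with derivative `∂ᵤS(x)`; `TopEigDanskinCurve`);
  `exists_abs_rpow_topEig_translate_sub_le` (`λ₁^q` is Lipschitz along lines).
* §3 `TopEig.integral_topEigWeight_dirTopEig_lineDeriv_eq_zero` — **`∫ W μ(S; ∂ᵤS) dx = 0`**: the
  slope integrals vanish for every `t` (translation invariance) and converge dominatedly; and
  `TopEig.ae_topEigWeight_dirTopEig_neg_lineDeriv` — **two-sidedness a.e.**:
  `W μ(S; −∂ᵤS) = −W μ(S; ∂ᵤS)` for a.e. `x` (both have integral `0`, and `μ(A; N) + μ(A; −N) ≥ 0`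
  pointwise, `dirTopEig_add_dirTopEig_neg_nonneg`).

No flow, no change of variables and no Rademacher theorem: one-sided slopes along constant
directions, translation invariance of `volume` on `UnitAddTorus d`, dominated convergence.
Refutation bookkeeping for CANDIDATE a priori inequalities; nothing here is about Navier–Stokes
regularity. [ours; Danskin folklore]
-/

noncomputable section

open MeasureTheory Set Filter Topology

namespace Summit.NavierStokesRegularity.FunctionalMining

open Literature.Analysis.FunctionSpaces Literature.Analysis.FluidPDE

namespace TopEig

open StrainL4 StrainTensor

variable {d : Type*} [Fintype d] [DecidableEq d] [Nonempty d]

/-! ## 1. Torus lemmas: slopes along a constant direction -/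

section Slopes

variable {F : Type*} [NormedAddCommGroup F] [NormedSpace ℝ F]

omit [Fintype d] [DecidableEq d] [Nonempty d] in
/-- `x + proj (t • (−u)) = x − proj (t • u)`. [folklore] -/
theorem add_proj_smul_neg (x : UnitAddTorus d) (t : ℝ) (u : EuclideanSpace ℝ d) :
    x + Torus.proj (t • (-u)) = x - Torus.proj (t • u) := by
  rw [smul_neg, Torus.proj_neg, sub_eq_add_neg]

omit [Fintype d] [DecidableEq d] [Nonempty d] in
/-- The torus directional derivative is odd in the direction (no differentiability needed).
[folklore] -/
theorem lineDeriv_neg_dir (f : UnitAddTorus d → F) (x : UnitAddTorus d) (u : EuclideanSpace ℝ d) :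
    Torus.lineDeriv f x (-u) = -Torus.lineDeriv f x u := by
  rw [Torus.lineDeriv_eq_lineDeriv_liftAt, Torus.lineDeriv_eq_lineDeriv_liftAt, lineDeriv_neg]

omit [Fintype d] [DecidableEq d] [Nonempty d] in
/-- A continuous function on the compact torus is bounded. [folklore] -/
theorem exists_forall_norm_le {G : Type*} [NormedAddCommGroup G] {f : UnitAddTorus d → G}
    (hf : Continuous f) : ∃ C, ∀ y, ‖f y‖ ≤ C := by
  obtain ⟨C, hC⟩ := isCompact_univ.exists_bound_of_continuousOn hf.continuousOn
  exact ⟨C, fun y => hC y (mem_univ y)⟩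

omit [DecidableEq d] [Nonempty d] in
/-- **Lipschitz along lines.** For a `C¹` function `f` on the torus and a direction `u` with
`‖∂ᵤ f‖ ≤ C` everywhere: `‖f (x + t u) − f (x)‖ ≤ C |t|` (mean value inequality along the line).
[folklore] -/
theorem norm_translate_sub_le {f : UnitAddTorus d → F} (hf : Torus.IsContDiff 1 f)
    {u : EuclideanSpace ℝ d} {C : ℝ} (hC : ∀ y, ‖Torus.lineDeriv f y u‖ ≤ C) (x : UnitAddTorus d)
    (t : ℝ) : ‖f (x + Torus.proj (t • u)) - f x‖ ≤ C * |t| := by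
  have h := (convex_univ (𝕜 := ℝ) (E := ℝ)).norm_image_sub_le_of_norm_hasDerivWithin_le
    (f := fun s : ℝ => f (x + Torus.proj (s • u)))
    (f' := fun s => Torus.lineDeriv f (x + Torus.proj (s • u)) u)
    (fun s _ => (Torus.hasDerivAt_comp_add_proj_smul hf x u s).hasDerivWithinAt)
    (fun s _ => hC _) (mem_univ 0) (mem_univ t)
  simpa only [zero_smul, Torus.proj_zero, add_zero, sub_zero, Real.norm_eq_abs] using h

omit [DecidableEq d] [Nonempty d] in
/-- Translation invariance: `∫ H(x) G(x + a) dx = ∫ H(y − a) G(y) dy`. [folklore] -/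
theorem integral_mul_translate (H G : UnitAddTorus d → ℝ) (a : UnitAddTorus d) :
    ∫ x, H x * G (x + a) = ∫ y, H (y - a) * G y := by
  have h := integral_add_right_eq_self (μ := volume) (fun y => H (y - a) * G y) a
  simp only [add_sub_cancel_right] at h
  exact h

omit [DecidableEq d] [Nonempty d] in
/-- **The slope moves onto the weight**: `∫ H · (G(· + a) − G)/t = ∫ G · (H(· − a) − H)/t` for
continuous `G, H` (translation invariance). [folklore] -/
theorem integral_mul_slope_comm {G H : UnitAddTorus d → ℝ} (hG : Continuous G) (hH : Continuous H)
    (a : UnitAddTorus d) (t : ℝ) :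
    ∫ x, H x * ((G (x + a) - G x) / t) = ∫ y, G y * ((H (y - a) - H y) / t) := by
  have hA : Integrable (fun x => H x * G (x + a)) volume :=
    (hH.mul (hG.comp (continuous_id.add continuous_const))).integrable_unitAddTorus
  have hB : Integrable (fun x => H x * G x) volume := (hH.mul hG).integrable_unitAddTorus
  have hC : Integrable (fun y => H (y - a) * G y) volume :=
    ((hH.comp (continuous_id.sub continuous_const)).mul hG).integrable_unitAddTorus
  have e1 : (fun x => H x * ((G (x + a) - G x) / t)) = fun x => (H x * G (x + a) - H x * G x) / t := by
    funext x; ring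
  have e2 : (fun y => G y * ((H (y - a) - H y) / t)) = fun y => (H (y - a) * G y - H y * G y) / t := by
    funext y; ring
  rw [e1, e2, integral_div, integral_div, integral_sub hA hB, integral_sub hC hB,
    integral_mul_translate H G a]

omit [DecidableEq d] [Nonempty d] in
/-- **Dominated convergence of weighted slopes along a direction.** If `G` is continuous,
Lipschitz along the `u`-lines (`|G(x + tu) − G(x)| ≤ C|t|`) and has a right derivative `G'(x)`
along `u` at EVERY `x`, then for continuous `H`: `∫ H · (G(· + tu) − G)/t → ∫ H G'` as `t → 0⁺`.
[folklore] -/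
theorem tendsto_integral_mul_slope {G G' H : UnitAddTorus d → ℝ} {u : EuclideanSpace ℝ d} {C : ℝ}
    (hG : Continuous G) (hH : Continuous H)
    (hLip : ∀ x (t : ℝ), |G (x + Torus.proj (t • u)) - G x| ≤ C * |t|)
    (hder : ∀ x, HasDerivWithinAt (fun t : ℝ => G (x + Torus.proj (t • u))) (G' x) (Ioi 0) 0) :
    Tendsto (fun t : ℝ => ∫ x, H x * ((G (x + Torus.proj (t • u)) - G x) / t)) (𝓝[>] 0)
      (𝓝 (∫ x, H x * G' x)) := by
  obtain ⟨B, hB⟩ := exists_forall_norm_le hH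
  have h0 : (0 : ℝ) ∉ Ioi (0 : ℝ) := fun h => lt_irrefl (0 : ℝ) h
  refine tendsto_integral_filter_of_dominated_convergence (fun _ => B * C) ?_ ?_
    (integrable_const _) ?_
  · exact Eventually.of_forall fun t =>
      (hH.mul (((hG.comp (continuous_id.add continuous_const)).sub hG).div_const t)).aestronglyMeasurable
  · filter_upwards [self_mem_nhdsWithin] with t ht
    have ht : 0 < t := ht
    refine Eventually.of_forall fun x => ?_
    rw [Real.norm_eq_abs, abs_mul, abs_div, abs_of_pos ht]
    have h1 : |G (x + Torus.proj (t • u)) - G x| / t ≤ C := by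
      rw [div_le_iff₀ ht]
      have h := hLip x t
      rwa [abs_of_pos ht] at h
    have hBx : |H x| ≤ B := by simpa only [Real.norm_eq_abs] using hB x
    exact mul_le_mul hBx h1 (div_nonneg (abs_nonneg _) ht.le) ((abs_nonneg _).trans hBx)
  · refine Eventually.of_forall fun x => ?_
    have h := ((hasDerivWithinAt_iff_tendsto_slope' h0).1 (hder x)).const_mul (H x)
    refine h.congr' ?_
    filter_upwards [self_mem_nhdsWithin] with t _
    rw [slope_def_field, zero_smul, Torus.proj_zero, add_zero, sub_zero]

end Slopes

/-! ## 2. The weight `λ₁^q` along translates: Lipschitz, Danskin -/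

variable {v : UnitAddTorus d → EuclideanSpace ℝ d} {q : ℝ}

/-- `λ₁` is bounded on the torus. [ours] -/
theorem exists_torusStrainTopEig_le (hv : Torus.IsSmooth v) : ∃ Λ, ∀ x, torusStrainTopEig v x ≤ Λ := by
  obtain ⟨Λ, hΛ⟩ := exists_forall_norm_le (continuous_torusStrainTopEig hv)
  exact ⟨Λ, fun x => (le_abs_self _).trans (by simpa only [Real.norm_eq_abs] using hΛ x)⟩

/-- **`λ₁^q` is Lipschitz along lines**: `|λ₁(x + tu)^q − λ₁(x)^q| ≤ C|t|` with one constant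
`C = q Λ^{q−1} sup‖∂ᵤS‖` (`r ↦ r^q` Lipschitz on `[0, Λ]`, `λ` `1`-Lipschitz, `S` smooth).
[ours] -/
theorem exists_abs_rpow_topEig_translate_sub_le (hq : 1 ≤ q) (hv : Torus.IsSmooth v)
    (hdv : Torus.IsDivFree v) (u : EuclideanSpace ℝ d) : ∃ C, ∀ x (t : ℝ),
    |torusStrainTopEig v (x + Torus.proj (t • u)) ^ q - torusStrainTopEig v x ^ q| ≤ C * |t| := by
  obtain ⟨Λ, hΛ⟩ := exists_torusStrainTopEig_le hv
  obtain ⟨B, hB⟩ := exists_forall_norm_le ((isSmooth_strainFlat hv).lineDeriv u).continuous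
  refine ⟨q * Λ ^ (q - 1) * B, fun x t => ?_⟩
  have hnn : ∀ y, 0 ≤ torusStrainTopEig v y := fun y => by
    rw [← lam_strainFlat]; exact lam_strainFlat_nonneg hv hdv y
  have h1 := abs_rpow_sub_rpow_le hq (hnn (x + Torus.proj (t • u))) (hnn x) (hΛ _) (hΛ x)
  have h2 : |torusStrainTopEig v (x + Torus.proj (t • u)) - torusStrainTopEig v x| ≤
      ‖strainFlat v (x + Torus.proj (t • u)) - strainFlat v x‖ := by
    rw [← lam_strainFlat, ← lam_strainFlat]; exact abs_lam_sub_lam_le _ _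
  have h3 := norm_translate_sub_le ((isSmooth_strainFlat hv).isContDiff (by simp)) hB x t
  have hK : 0 ≤ q * Λ ^ (q - 1) :=
    mul_nonneg (by linarith) (Real.rpow_nonneg ((hnn x).trans (hΛ x)) _)
  calc |torusStrainTopEig v (x + Torus.proj (t • u)) ^ q - torusStrainTopEig v x ^ q|
      ≤ q * Λ ^ (q - 1) * |torusStrainTopEig v (x + Torus.proj (t • u)) - torusStrainTopEig v x| := h1
    _ ≤ q * Λ ^ (q - 1) * (B * |t|) := mul_le_mul_of_nonneg_left (h2.trans h3) hK
    _ = q * Λ ^ (q - 1) * B * |t| := by ring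

/-- **Danskin along a translate.** For every `x` and every direction `u`, `t ↦ λ₁(x + tu)^q` has the
RIGHT derivative `q λ₁(x)^{q−1} μ(S(x); ∂ᵤS(x))` at `t = 0` (`q ≥ 1`; the strain of the translate
is the curve `t ↦ S(x + tu)` with derivative `∂ᵤS(x)`, and `hasDerivWithinAt_lam_comp_rpow`).
[ours; Danskin] -/
theorem hasDerivWithinAt_rpow_topEig_translate (hq : 1 ≤ q) (hv : Torus.IsSmooth v)
    (x : UnitAddTorus d) (u : EuclideanSpace ℝ d) :
    HasDerivWithinAt (fun t : ℝ => torusStrainTopEig v (x + Torus.proj (t • u)) ^ q)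
      (q * torusStrainTopEig v x ^ (q - 1) *
        dirTopEig (strainFlat v x) (Torus.lineDeriv (strainFlat v) x u)) (Ioi 0) 0 := by
  have hA := (Torus.hasDerivAt_comp_add_proj_smul ((isSmooth_strainFlat hv).isContDiff (by simp))
    x u 0).hasDerivWithinAt (s := Ioi 0)
  simp only [zero_smul, Torus.proj_zero, add_zero] at hA
  have h := hasDerivWithinAt_lam_comp_rpow hA hq
  simp only [zero_smul, Torus.proj_zero, add_zero, lam_strainFlat] at h
  exact h

/-- The slopes `(λ₁(x + tu)^q − λ₁(x)^q)/t` converge to `q λ₁^{q−1} μ(S; ∂ᵤS)` as `t → 0⁺`, at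
every `x`. [ours] -/
theorem tendsto_slope_rpow_topEig_translate (hq : 1 ≤ q) (hv : Torus.IsSmooth v)
    (x : UnitAddTorus d) (u : EuclideanSpace ℝ d) :
    Tendsto (fun t : ℝ => (torusStrainTopEig v (x + Torus.proj (t • u)) ^ q -
      torusStrainTopEig v x ^ q) / t) (𝓝[>] 0)
      (𝓝 (q * torusStrainTopEig v x ^ (q - 1) *
        dirTopEig (strainFlat v x) (Torus.lineDeriv (strainFlat v) x u))) := by
  have h0 : (0 : ℝ) ∉ Ioi (0 : ℝ) := fun h => lt_irrefl (0 : ℝ) h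
  have h := (hasDerivWithinAt_iff_tendsto_slope' h0).1
    (hasDerivWithinAt_rpow_topEig_translate hq hv x u)
  refine h.congr' ?_
  filter_upwards [self_mem_nhdsWithin] with t _
  rw [slope_def_field, zero_smul, Torus.proj_zero, add_zero, sub_zero]

/-! ## 3. The one-sided channel `W μ(S; ∂ᵤS)`: zero integral, two-sided almost everywhere -/

/-- **`∫ q λ₁^{q−1} μ(S; ∂ᵤS) dx = 0`** for smooth divergence-free `v`, `q ≥ 1`, any direction `u`:
each slope integral `∫ (λ₁(x + tu)^q − λ₁(x)^q)/t dx` vanishes (translation invariance), and the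
slopes converge dominatedly. [ours] -/
theorem integral_topEigWeight_dirTopEig_lineDeriv_eq_zero (hq : 1 ≤ q) (hv : Torus.IsSmooth v)
    (hdv : Torus.IsDivFree v) (u : EuclideanSpace ℝ d) :
    ∫ x, q * torusStrainTopEig v x ^ (q - 1) *
      dirTopEig (strainFlat v x) (Torus.lineDeriv (strainFlat v) x u) = 0 := by
  obtain ⟨C, hC⟩ := exists_abs_rpow_topEig_translate_sub_le hq hv hdv u
  have hg : Continuous fun x => torusStrainTopEig v x ^ q :=
    (continuous_torusStrainTopEig hv).rpow_const fun _ => Or.inr (by linarith)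
  have hlim := tendsto_integral_mul_slope (H := fun _ => (1 : ℝ)) hg continuous_const hC
    (fun x => hasDerivWithinAt_rpow_topEig_translate hq hv x u)
  simp only [one_mul] at hlim
  have hzero : ∀ t : ℝ, ∫ x, (torusStrainTopEig v (x + Torus.proj (t • u)) ^ q -
      torusStrainTopEig v x ^ q) / t = 0 := fun t => by
    have htr : ∫ x, torusStrainTopEig v (x + Torus.proj (t • u)) ^ q =
        ∫ x, torusStrainTopEig v x ^ q :=
      integral_add_right_eq_self (μ := volume) (fun y => torusStrainTopEig v y ^ q) _
    have hi : Integrable (fun x => torusStrainTopEig v (x + Torus.proj (t • u)) ^ q) volume :=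
      (hg.comp (continuous_id.add continuous_const)).integrable_unitAddTorus
    rw [integral_div, integral_sub hi hg.integrable_unitAddTorus, htr, sub_self, zero_div]
  have hconst : Tendsto (fun t : ℝ => ∫ x, (torusStrainTopEig v (x + Torus.proj (t • u)) ^ q -
      torusStrainTopEig v x ^ q) / t) (𝓝[>] 0) (𝓝 0) := by
    simp only [hzero]; exact tendsto_const_nhds
  exact tendsto_nhds_unique hlim hconst

/-- **Two-sidedness almost everywhere.** For a.e. `x`:
`q λ₁^{q−1} μ(S; −∂ᵤS) = −q λ₁^{q−1} μ(S; ∂ᵤS)` — both channels have integral `0`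
(`∂₋ᵤS = −∂ᵤS`) and their sum is pointwise `≥ 0`. [ours] -/
theorem ae_topEigWeight_dirTopEig_neg_lineDeriv (hq : 1 ≤ q) (hv : Torus.IsSmooth v)
    (hdv : Torus.IsDivFree v) (u : EuclideanSpace ℝ d) :
    ∀ᵐ x : UnitAddTorus d, q * torusStrainTopEig v x ^ (q - 1) *
        dirTopEig (strainFlat v x) (-Torus.lineDeriv (strainFlat v) x u) =
      -(q * torusStrainTopEig v x ^ (q - 1) *
        dirTopEig (strainFlat v x) (Torus.lineDeriv (strainFlat v) x u)) := by
  have hS := isSmooth_strainFlat hv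
  have hpos : Integrable (fun x => q * torusStrainTopEig v x ^ (q - 1) *
      dirTopEig (strainFlat v x) (Torus.lineDeriv (strainFlat v) x u)) volume :=
    integrable_topEigDensity hq hv hdv (hS.lineDeriv u).continuous
  have hneg : Integrable (fun x => q * torusStrainTopEig v x ^ (q - 1) *
      dirTopEig (strainFlat v x) (-Torus.lineDeriv (strainFlat v) x u)) volume :=
    integrable_topEigDensity hq hv hdv (hS.lineDeriv u).continuous.neg
  have hint_neg : ∫ x, q * torusStrainTopEig v x ^ (q - 1) *
      dirTopEig (strainFlat v x) (-Torus.lineDeriv (strainFlat v) x u) = 0 := by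
    have h := integral_topEigWeight_dirTopEig_lineDeriv_eq_zero hq hv hdv (-u)
    simp only [lineDeriv_neg_dir] at h
    exact h
  have hsum0 : ∫ x, (q * torusStrainTopEig v x ^ (q - 1) *
      dirTopEig (strainFlat v x) (Torus.lineDeriv (strainFlat v) x u) +
      q * torusStrainTopEig v x ^ (q - 1) *
      dirTopEig (strainFlat v x) (-Torus.lineDeriv (strainFlat v) x u)) = 0 := by
    rw [integral_add hpos hneg, integral_topEigWeight_dirTopEig_lineDeriv_eq_zero hq hv hdv u,
      hint_neg, add_zero]
  have hnn : ∀ x, 0 ≤ q * torusStrainTopEig v x ^ (q - 1) *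
      dirTopEig (strainFlat v x) (Torus.lineDeriv (strainFlat v) x u) +
      q * torusStrainTopEig v x ^ (q - 1) *
      dirTopEig (strainFlat v x) (-Torus.lineDeriv (strainFlat v) x u) := fun x => by
    have hl : 0 ≤ torusStrainTopEig v x := by
      rw [← lam_strainFlat]; exact lam_strainFlat_nonneg hv hdv x
    have hW : 0 ≤ q * torusStrainTopEig v x ^ (q - 1) := mul_nonneg (by linarith) (Real.rpow_nonneg hl _)
    rw [← mul_add]
    exact mul_nonneg hW (dirTopEig_add_dirTopEig_neg_nonneg _ _)
  have hae := (integral_eq_zero_iff_of_nonneg hnn (hpos.add hneg)).1 hsum0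
  filter_upwards [hae] with x hx
  have hx' : q * torusStrainTopEig v x ^ (q - 1) *
      dirTopEig (strainFlat v x) (Torus.lineDeriv (strainFlat v) x u) +
      q * torusStrainTopEig v x ^ (q - 1) *
      dirTopEig (strainFlat v x) (-Torus.lineDeriv (strainFlat v) x u) = 0 := hx
  linarith

end TopEig

end Summit.NavierStokesRegularity.FunctionalMining

end
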